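/-
Copyright (c) 2026 the pub-hodgecm-mathlib formalisation cell (harness21).  Prover seat hodgecm-mathlib-F0P3b-p01 (g25); E1 keeper ∕ dealer F0P3a-p03 (g30) «= β ⊇ α, GO
sigsheet-first» 2026-09-03T02:54:45Z (E1 BRICK LEDGER row 40‴α; consumer = row 40″ K2′-SENTENCE's height oracle (H) at the CM datum, row 40‴β).
-/
import Literature.RepresentationTheory.CharacterSelfExtensionJacquetAlternative   -- ★ row 40′ p853320∕p853344: `exists_scalar_additive` (the scalar additive character `λ` and its OCCURRENCE relation)
import Literature.Topology.Algebra.LocallyConstantAdditiveCompact            -- ★ LC-ADDITIVE p852883: `eq_zero_on_compact_of_eq_zero_on_open`, `torsionFree_of_charZero`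
import Literature.NumberTheory.Automorphic.SmoothRepresentation                -- ★ `Representation.IsSmooth`, `stabilizerSubgroup`, `mem_stabilizerSubgroup`
import HarnessLib

/-!
# The additive character of a SMOOTH self-extension of a character kills every compact subgroup

Generic (topological group `M`, field `k` of characteristic `0`), Mathlib + ★ `CharacterSelfExtensionJacquetAlternative` + ★ `LocallyConstantAdditiveCompact` + ★
`SmoothRepresentation`, THEOREMS ONLY (no `def`, no instance, no named fact).  Namespace `Literature.RepresentationTheory`.  Cell `pub/hodgecm-mathlib`, crux H413 =
`stmt-HodgeConjecture-24833` (`--supports` lane), E1 BRICK LEDGER row 40‴α: the generic half of the HEIGHT-ORACLE discharge (row 40‴β) for ★ row 40″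
`F0P3cStCharTSK2PiTwoSelfExtSplitSentence` — at the CM datum the occurring additive character `λ` of `r_B τ` must kill `T ∩ K_v` for ★ H2 `exists_height_cmBorel` to give its height.
Seat F0P3b-p01 (g25).

THE MATHEMATICS.  `N : Representation k M U` a self-extension of the character `χ` in ★ CHAR-EXT letters (`p`, `u₀`, `e`, `hfree`) with OCCURRING scalar additive character `λ`:
`N m u₀ − χ m • u₀ = (χ m · λ m) • e` (★ row 40′ `exists_scalar_additive`).  (1) If `m` FIXES `u₀` then `λ m = 0`: applying `p` to the relation gives `1 − χ m = 0`, so the relation reads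
`0 = λ m • e`.  (2) Hence if `N` is SMOOTH (open stabilisers) `λ` vanishes on the open subgroup `Stab(u₀)`, and an additive map into the torsion-free group `k` vanishing on an open
subgroup vanishes on every COMPACT subgroup (★ LC-ADDITIVE `eq_zero_on_compact_of_eq_zero_on_open` + `torsionFree_of_charZero`).  At the datum: `M = T(L⁺_v)`, `C = T ∩ K_v`.
* `additive_eq_zero_of_apply_base_eq` — (1).   * `additive_eq_zero_on_stabilizer` — `λ = 0` on `Stab_N(u₀)`.   * **`additive_eq_zero_on_compact_of_isSmooth`** — (2).
[cite: Brown1982, Ch. III §1 Exercise 2 p. 60] [cite: BourbakiGT1, Ch. III §2 no. 1] [cite: BushnellHenniart2006, §1.1]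
HONEST LABEL: count-neutral generic layer; HC_CM is proved only modulo the printed citations of that programme until its rung 0 closes.

## References
* [Brown1982] K. S. Brown, *Cohomology of Groups*, GTM 87 (1982), Ch. III §1 Exercise 2 p. 60.
* [BourbakiGT1] N. Bourbaki, *General Topology*, Ch. III §2 no. 1 (open subgroups of compact groups have finite index).
* [BushnellHenniart2006] C. J. Bushnell, G. Henniart, *The Local Langlands Conjecture for GL(2)*, §1.1 (smooth representations: open stabilisers).
-/

set_option autoImplicit false

namespace Literature.RepresentationTheory

open Representation

section SmoothAdditive

variable {k : Type*} [Field k] {M : Type*} [Group M] {U : Type*} [AddCommGroup U] [Module k U]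
  (N : Representation k M U) (χ : M →* k) (p : U →ₗ[k] k) {u₀ e : U} (hu₀ : p u₀ = 1) (he : p e = 0) (hfree : ∀ c : k, c • e = 0 → c = 0)
  (lam : M → k) (hocc : ∀ m : M, N m u₀ - χ m • u₀ = (χ m * lam m) • e)

include hu₀ he hfree hocc in
/-- **IF `m` FIXES THE BASE VECTOR THEN `λ m = 0`**: applying `p` to `N m u₀ − χ m u₀ = (χ m · λ m) e` with `N m u₀ = u₀` gives `χ m = 1`, whence `λ m • e = 0`.
[cite: Brown1982, Ch. III §1 Exercise 2 p. 60] -/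
theorem additive_eq_zero_of_apply_base_eq {m : M} (hm : N m u₀ = u₀) : lam m = 0 := by
  have h := hocc m
  rw [hm] at h
  have hχ : χ m = 1 := by
    have hp := congrArg p h
    rw [map_sub, map_smul, map_smul, hu₀, he, smul_eq_mul, smul_eq_mul, mul_one, mul_zero, sub_eq_zero] at hp
    exact hp.symm
  rw [hχ, one_smul, sub_self, one_mul] at h
  exact hfree _ h.symm

include hu₀ he hfree hocc in
/-- `λ` vanishes on the stabiliser of the base vector `u₀`. [cite: Brown1982, Ch. III §1 Exercise 2 p. 60] [cite: BushnellHenniart2006, §1.1] -/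
theorem additive_eq_zero_on_stabilizer (m : M) (hm : m ∈ N.stabilizerSubgroup u₀) : lam m = 0 :=
  additive_eq_zero_of_apply_base_eq N χ p hu₀ he hfree lam hocc ((mem_stabilizerSubgroup N u₀ m).1 hm)

variable [TopologicalSpace M] [IsTopologicalGroup M]

include hu₀ he hfree hocc in
/-- **THE ADDITIVE CHARACTER OF A SMOOTH SELF-EXTENSION KILLS EVERY COMPACT SUBGROUP** (characteristic `0`): `λ` is additive and vanishes on the OPEN stabiliser `Stab_N(u₀)`
(smoothness), hence on every compact subgroup `C ≤ M` (★ LC-ADDITIVE: an open subgroup of a compact group has finite index; `k` is torsion-free).  At the CM datum: `M = T(L⁺_v)`,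
`N = r_B τ`, `C = T ∩ K_v` — the input of ★ H2 `exists_height_cmBorel`. [cite: Brown1982, Ch. III §1 Exercise 2 p. 60] [cite: BourbakiGT1, Ch. III §2 no. 1] [cite: BushnellHenniart2006, §1.1] -/
theorem additive_eq_zero_on_compact_of_isSmooth [CharZero k] (hN : N.IsSmooth) (hlam : ∀ m m' : M, lam (m * m') = lam m + lam m')
    (C : Subgroup M) (hC : IsCompact (C : Set M)) (c : M) (hc : c ∈ C) : lam c = 0 :=
  Literature.Topology.Algebra.eq_zero_on_compact_of_eq_zero_on_open lam hlam C hC (N.stabilizerSubgroup u₀) (hN u₀)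
    (fun m hm => additive_eq_zero_on_stabilizer N χ p hu₀ he hfree lam hocc m hm)
    (fun n w hn h => Literature.Topology.Algebra.torsionFree_of_charZero (k := k) n w hn h) c hc

end SmoothAdditive

end Literature.RepresentationTheory
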